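import Literature.MathematicalPhysics.QuantumFieldTheory.Balaban1983to89.Beta.AdjointTransportJets

/-!
# `Balaban1983to89.B9Eq37Insertion` — the EXACT-BACKGROUND insertion (3.2)/(3.6) → (3.7) per plaquette, with
# Bałaban's complexified `Re U₀(∂p)`, `Im U₀(∂p)` (B9 p. 391), kernel-checked; v1

CITATION HEADER (lean-in-tree rule).  Audit cell `pub-balaban`, surge node-prover lineage pv27 (B9 pp. 390–392), unit
`b2b-balaban-pv27-g14`.  Source: T. Bałaban, *Propagators for lattice gauge theories in a background field*, Commun. Math.
Phys. **99** (1985) 389–434 [Balaban1985BackgroundPropagators] (cell paper B9; journal page = PDF page + 388), pp. 390–392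
[PDF 2–4], quoted from the page renders `b2b-balaban-ref1/pages/1985-cmp99-background-propagators/…-p002-x2.png`,
`…-p003-x2.png`, `…-p004-x2.png` READ AS IMAGES by this seat (2026-08-19).

HONEST FRAMING (cell charter, verbatim in substance).  The cell audits Bałaban's papers; discharging its end statements would
make Bałaban's ultraviolet stability theorem unconditional inside this package — a constructive-QFT statement; it is NOT the
continuum limit and NOT the Clay problem.  THIS FILE DISCHARGES NOTHING of the series: it is finite non-commutative algebra plus
the third-order Taylor remainder of `Beta.TransportVertices` (imported BY NAME), certifying ONE printed sentence — that the
second-order expansion (3.7) of the Wilson action around a background holds VERBATIM for complex configurations once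
`Re U₀(∂p)`, `Im U₀(∂p)` are read as Bałaban prescribes — with the background plaquette variable kept EXACT (all orders in
`U₀`, second order in the fluctuation).  Value = kernel certificate of a located printed identity; NOT summit progress.

ABSOLUTE RULE.  No internally-minted statement enters as a cited fact.  Every declaration below is PROVED (tags `[folklore]`);
the `[cite: …]` tags on §3–§5 document WHICH PRINTED DISPLAY a proved statement transcribes — the proof is ours, the print is
not used as a hypothesis anywhere.

WHAT IS IN PRINT (context; «…» verbatim from the renders).
* p. 390 [PDF 2] (3.1): «A^η(U′U₀) = Σ_{p⊂T_η} η^{d−4}[1 − Re tr(U′U₀)(∂p)],  tr(U′U₀)(∂p) = tr(∂₀U′)((p)_z)U₀(∂p), where for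
  a plaquette p = ⟨x, y, z, w⟩ we define (p)_z = ⟨z, w, x, y⟩, and (∂₀U′)((p)_z) = R(U₀(x,w))U′(z,w)U′(w,x)U′(x,y)R(U₀(x,y))U′(y,z).
  Let us recall that R(U)X = UXU⁻¹.»; «We take U = U′U₀, U′ = exp iηA»; (3.2): «(∂₀U′)((p)_z) = 1 + iη Σ_{b⊂∂(p)_z} A′(b)
  − ½η[Σ_{b⊂∂(p)_z} (A′(b))² + 2 Σ_{b₁,b₂⊂∂(p)_z, b₁≺b₂} A′(b₁)A′(b₂)] + ⋯» [sic: `η` to the first power in this line of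
  the print; the unexpanded line above it has `−½η²`; recorded in the cell's GAPS G-adv8-7 (i)] «where A′(b) are defined for
  bonds b ⊂ ∂(p)_z by the equalities A′(z,w) = R(U₀(x,w))A(z,w), A′(w,x) = A(w,x), A′(x,y) = A(x,y), A′(y,z) = R(U₀(x,y))·A(y,z),
  and ≺ denotes a natural ordering among bonds of the oriented contour ∂(p)_z».
* p. 391 [PDF 3] (3.4): «(D^η_{U₀}A)(p) = η⁻¹(A(x,y) + R(U₀(x,y))A(y,z) + R(U₀(x,w))A(z,w) + A(w,x))»; (3.5): «U(x,x′) = U⁻¹(x′,x),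
  A(x,x′) = −A(x′,x) for a bond ⟨x,x′⟩.»; (3.6): «(∂₀U′)((p)_z) = 1 + iη²(D^η_{U₀}A)(p) − ½η⁴((D^η_{U₀}A)(p))²
  + iη² Σ_{b₁,b₂⊂∂(p)_z, b₁≺b₂} i[A′(b₁), A′(b₂)] + ⋯» [the coefficient of the last term is `½·iη²` — GAPS G-adv8-7 (ii) =
  G-an2-16, see the NOTE in `Beta.TransportVertices`; §4 below reproduces the ½]; «and we get
  A^η(U′U₀) = A^η(U₀) + Σ_{p⊂T_η} η^d tr(D^η_{U₀}A)(p)η⁻² Im U₀(∂p) + ½ Σ_{p⊂T_η} η^d [tr((D^η_{U₀}A)(p))² Re U₀(∂p)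
  + tr Σ_{b₁,b₂⊂∂(p)_z, b₁≺b₂} i[A′(b₁), A′(b₂)]η⁻² Im U₀(∂p)] + ⋯ = A^η(U₀) + ⟨D^η_{U₀}A, η⁻² Im ∂U₀⟩ + ½⟨A, Δ^η(U₀)A⟩
  + ⋯. (3.7)  This expansion is valid also for configurations A and U₀ with values respectively in the complexified algebra
  g^c and the group G^c, we have to interpret only Re U₀(∂p) and Im U₀(∂p) as  Re U₀(∂p) = ½(U₀(∂p) + U₀(−∂p)),
  Im U₀(∂p) = (1/2i)(U₀(∂p) − U₀(−∂p)).  Here −∂p is the contour ∂(−p), and U₀(−∂p) = (U₀(∂p))⁻¹.»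
* p. 392 [PDF 4]: «Let us recall that the trace is normalized, i.e., tr 1 = 1.»; «The quadratic terms in the expansion (3.7)
  define the basic operator generalizing the operator ∂*∂ in the Abelian case. We denote it by Δ^η(U), or simply by Δ.»

WHAT THIS FILE PROVES (`𝔸` a complete normed `ℂ`-algebra — no commutativity, no `‖1‖ = 1`, no unitarity; `τ : 𝔸 →ₗ[ℂ] ℂ`
an arbitrary TRACIAL linear functional, `τ(ab) = τ(ba)`; the background plaquette variable `W = U₀(∂p)` an arbitrary UNIT `𝔸ˣ`).
* §1 Print's complexified parts `reC W = ½(W + W⁻¹)`, `imC W = (1/2i)(W − W⁻¹)` and their bookkeeping: `W = reC W + i·imC W`,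
  `W⁻¹ = reC W − i·imC W`, `reC 1 = 1`, `imC 1 = 0`, and ORIENTATION REVERSAL (3.5) `reC W⁻¹ = reC W`, `imC W⁻¹ = −imC W`;
  the per-plaquette Wilson functional in this reading, `wil τ W = τ 1 − τ (reC W)` (the summand `1 − Re tr U(∂p)` of (3.1) at
  `η^{d−4} = 1`; the power of `η` is restored in §4).
* §2 THE INSERTION IDENTITY (pure algebra, `insertion_alg`): for `σ, c ∈ 𝔸` and `q = ½(σ² + c)`, `q′ = ½(σ² − c)`,
  `−½ τ((σ + q)W + W⁻¹(−σ + q′)) = −i·τ(σ·imC W) − ½ τ(σ²·reC W) − (i/2)·τ(c·imC W)`.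
* §3 THE EXACT-BACKGROUND EXPANSION (`wil_holonomy_mul`): for a list of fluctuation letters `l = [a₁, …, a_n]` with ordered
  product `P = holonomy l = e^{a₁}⋯e^{a_n}` (a unit, inverse `holonomy (invPath l)` — `Beta.AdjointTransportJets` BY NAME),
  `σ = Σ a_k`, `c = commSum l = Σ_{j<k}[a_j, a_k]`:
  `wil τ (P·W) − wil τ W = −i·τ(σ·imC W) − ½ τ(σ²·reC W) − (i/2)·τ(c·imC W) − ½(τ(E·W) + τ(W⁻¹·E′))`
  with the third-order remainders `E = P − 1 − σ − quad l`, `E′ = P⁻¹ − 1 + σ − quad (invPath l)`,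
  `‖E‖, ‖E′‖ ≤ expTail 3 (Σ‖a_k‖) ≤ (Σ‖a_k‖)³ e^{Σ‖a_k‖}/6` (`Beta.TransportVertices.norm_holonomy_sub_taylor_two_le` BY NAME,
  `size_invPath`); for a CONTINUOUS `τ` the remainder is bounded by `½‖τ‖(‖W‖ + ‖W⁻¹‖)·expTail 3 (Σ‖a_k‖)` (`norm_rem_le`).
* §4 BAŁABAN'S LETTERS (`eq37_summand`, `eq37_summand_dim`, `eq36_half`): `a_k = iη·A′_k`, `X := η⁻¹ Σ_k A′_k` (print's
  `(D^η_{U₀}A)(p)` by (3.4) — a NOTATION here, (3.4) is not asserted), `C := commSum [A′₁, …] = Σ_{b₁≺b₂}[A′(b₁), A′(b₂)]`: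
  `wil τ (P·W) − wil τ W = η² τ(X·imC W) + ½η⁴ τ(X²·reC W) + ½η² τ((i·C)·imC W) + (remainder of §3)`, i.e. after the factor
  `η^{d−4}`: `η^d τ(X·η⁻² imC W) + ½η^d[τ(X²·reC W) + τ((i·C)·η⁻² imC W)]` — the (3.7) summand LETTER FOR LETTER, coefficient ½
  on the commutator term; and the plaquette variable itself, (3.6) with the ½: `P = 1 + iη²X − ½η⁴X² + ½·iη²·(iC) + E`.
* §5 CONSISTENCY WITH (3.1) ON THE GROUP (`[StarRing 𝔸] [StarModule ℂ 𝔸]`, `W⁻¹ = W*`, `τ(a*) = conj τ(a)`): `reC W`, `imC W`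
  are self-adjoint, `τ(reC W) = Re τ(W)`, `τ(imC W) = Im τ(W)`, hence `wil τ W = 1 − Re τ(W)` when `τ 1 = 1` («tr 1 = 1»); and
  the three coefficient traces of §4 are REAL when the `A′(b)` are self-adjoint (`star (commSum l) = −commSum l`).

RELATED IN THE TREE, NOT DUPLICATED (searched 2026-08-19): `Beta.WilsonVertex` / `Beta.PlaquetteVertex` / `Beta.PlaquetteBackground`
type the graded `(2,1)`-JETS of the action with the background ALSO expanded (coordinates, finite lattice); `Beta.TransportVertices`
is the pure-fluctuation ordered product `Π e^{a_k}` to second order + the NOTE on (3.6)'s ½; `Beta.AdjointTransportJets` the jets of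
`P·X·P⁻¹` (it supplies `invPath`, `holUnit` used here); `B12Membership314.plaquette_mul_background` is (3.1) without the trace, at
the level of words; `Beta.LogDetVariation` §3 is the unitary-MATRIX `Re u = ½(u + uᴴ)` with `1 − Re u ≥ 0`.  None keeps `U₀(∂p)`
EXACT inside the second-order insertion or types the complexified `Re`/`Im` of p. 391 for a general unit.

NOT PROVED HERE, NOT CLAIMED: (3.1) itself (the cyclic rearrangement `tr U(∂p) = tr(∂₀U′)((p)_z)U₀(∂p)` is
`B12Membership314.plaquette_mul_background` at the level of words; the identification of `Σ_b A′(b)` with `η(D^η_{U₀}A)(p)` is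
(3.4), a definition of the print), the sum over plaquettes, any statement about `Δ^η(U₀)`, `Δ′`, the propagators or the
series' theorems.  Records: GAPS C-pv27-67; the (3.6) coefficient is the EXISTING record G-adv8-7 (ii)/G-an2-16 (nothing new
minted).  NOT summit progress.
-/

noncomputable section

open NormedSpace Complex

namespace Literature.MathematicalPhysics.QuantumFieldTheory.Balaban1983to89.B9Eq37Insertion

open Literature.MathematicalPhysics.QuantumFieldTheory.Balaban1983to89.Beta.TransportVertices
open Literature.MathematicalPhysics.QuantumFieldTheory.Balaban1983to89.Beta.AdjointTransportJets

/-! ## §1  Bałaban's complexified real and imaginary parts of a plaquette variable (p. 391) -/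

section ReIm

variable {𝔸 : Type*} [Ring 𝔸] [Algebra ℂ 𝔸]

/-- «Re U₀(∂p) = ½(U₀(∂p) + U₀(−∂p))» with «U₀(−∂p) = (U₀(∂p))⁻¹» (B9 p. 391): the complexified real part of a unit.
[folklore] [cite: Balaban1985BackgroundPropagators, p.391] -/
def reC (W : 𝔸ˣ) : 𝔸 := (2 : ℂ)⁻¹ • ((W : 𝔸) + ((W⁻¹ : 𝔸ˣ) : 𝔸))

/-- «Im U₀(∂p) = (1/2i)(U₀(∂p) − U₀(−∂p))» (B9 p. 391): the complexified imaginary part of a unit.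
[folklore] [cite: Balaban1985BackgroundPropagators, p.391] -/
def imC (W : 𝔸ˣ) : 𝔸 := (2 * I)⁻¹ • ((W : 𝔸) - ((W⁻¹ : 𝔸ˣ) : 𝔸))

/-- `(1/2i) = −i/2`: the imaginary part without a complex denominator. [folklore] -/
theorem imC_eq (W : 𝔸ˣ) : imC W = (-(I / 2)) • ((W : 𝔸) - ((W⁻¹ : 𝔸ˣ) : 𝔸)) := by
  unfold imC
  congr 1
  rw [mul_inv, Complex.inv_I]
  ring

/-- `W = Re W + i·Im W`. [folklore] -/
theorem reC_add_I_smul_imC (W : 𝔸ˣ) : reC W + I • imC W = (W : 𝔸) := by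
  rw [reC, imC_eq, smul_smul]
  have h : I * -(I / 2) = (2 : ℂ)⁻¹ := by
    rw [mul_neg, mul_div_assoc', Complex.I_mul_I]; norm_num
  have hs : ((W : 𝔸) + ((W⁻¹ : 𝔸ˣ) : 𝔸)) + ((W : 𝔸) - ((W⁻¹ : 𝔸ˣ) : 𝔸)) = (2 : ℂ) • (W : 𝔸) := by
    rw [two_smul]; abel
  rw [h, ← smul_add, hs, smul_smul, inv_mul_cancel₀ two_ne_zero, one_smul]

/-- `W⁻¹ = Re W − i·Im W`. [folklore] -/
theorem reC_sub_I_smul_imC (W : 𝔸ˣ) : reC W - I • imC W = ((W⁻¹ : 𝔸ˣ) : 𝔸) := by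
  rw [reC, imC_eq, smul_smul]
  have h : I * -(I / 2) = (2 : ℂ)⁻¹ := by
    rw [mul_neg, mul_div_assoc', Complex.I_mul_I]; norm_num
  have hs : ((W : 𝔸) + ((W⁻¹ : 𝔸ˣ) : 𝔸)) - ((W : 𝔸) - ((W⁻¹ : 𝔸ˣ) : 𝔸)) = (2 : ℂ) • ((W⁻¹ : 𝔸ˣ) : 𝔸) := by
    rw [two_smul]; abel
  rw [h, ← smul_sub, hs, smul_smul, inv_mul_cancel₀ two_ne_zero, one_smul]

/-- `W + W⁻¹ = 2·Re W`. [folklore] -/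
theorem val_add_inv (W : 𝔸ˣ) : (W : 𝔸) + ((W⁻¹ : 𝔸ˣ) : 𝔸) = (2 : ℂ) • reC W := by
  rw [reC, smul_smul, mul_inv_cancel₀ two_ne_zero, one_smul]

/-- `W − W⁻¹ = 2i·Im W`. [folklore] -/
theorem val_sub_inv (W : 𝔸ˣ) : (W : 𝔸) - ((W⁻¹ : 𝔸ˣ) : 𝔸) = (2 * I) • imC W := by
  rw [imC, smul_smul, mul_inv_cancel₀ (mul_ne_zero two_ne_zero I_ne_zero), one_smul]

/-- At the trivial background `Re 1 = 1`. [folklore] -/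
@[simp] theorem reC_one : reC (1 : 𝔸ˣ) = 1 := by
  rw [reC, inv_one, Units.val_one, ← two_smul ℂ, smul_smul, inv_mul_cancel₀ two_ne_zero, one_smul]

/-- At the trivial background `Im 1 = 0`. [folklore] -/
@[simp] theorem imC_one : imC (1 : 𝔸ˣ) = 0 := by
  simp [imC]

/-- ORIENTATION REVERSAL (3.5), `U₀(−∂p) = (U₀(∂p))⁻¹`: the complexified real part is EVEN. [folklore] -/
theorem reC_inv (W : 𝔸ˣ) : reC W⁻¹ = reC W := by
  rw [reC, reC, inv_inv, add_comm]

/-- ORIENTATION REVERSAL (3.5): the complexified imaginary part is ODD (so `tr(D^η_{U₀}A)(p)·Im U₀(∂p)` does not depend on the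
orientation of `p`, `(D^η_{U₀}A)(−p) = −(D^η_{U₀}A)(p)` being odd too, p. 391). [folklore] -/
theorem imC_inv (W : 𝔸ˣ) : imC W⁻¹ = -imC W := by
  rw [imC, imC, inv_inv, ← smul_neg, neg_sub]

/-- THE PER-PLAQUETTE WILSON FUNCTIONAL IN THE COMPLEXIFIED READING: `wil τ W = τ 1 − τ(Re W)` — the summand
`1 − Re tr U(∂p)` of (3.1) (normalized trace, p. 392; factor `η^{d−4}` restored in §4) with `Re` read as on p. 391.
[folklore] [cite: Balaban1985BackgroundPropagators, (3.1) p.390, p.391] -/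
def wil (τ : 𝔸 →ₗ[ℂ] ℂ) (W : 𝔸ˣ) : ℂ := τ 1 - τ (reC W)

/-- At the trivial background the functional vanishes. [folklore] -/
@[simp] theorem wil_one (τ : 𝔸 →ₗ[ℂ] ℂ) : wil τ 1 = 0 := by
  simp [wil]

/-- The functional is orientation-independent: `wil τ W⁻¹ = wil τ W`. [folklore] -/
theorem wil_inv (τ : 𝔸 →ₗ[ℂ] ℂ) (W : 𝔸ˣ) : wil τ W⁻¹ = wil τ W := by
  rw [wil, wil, reC_inv]

end ReIm

/-! ## §2  The insertion identity (pure algebra) -/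

section Insertion

variable {𝔸 : Type*} [Ring 𝔸] [Algebra ℂ 𝔸]

/-- **THE INSERTION IDENTITY.**  For a tracial `τ`, a unit `W` and `σ, c ∈ 𝔸` with `q = ½(σ² + c)`, `q′ = ½(σ² − c)` (the
second-order Taylor terms of an ordered product of exponentials with letter sum `σ` and ordered commutator sum `c`, and of the
product along the inverse path):
`−½ τ((σ + q)·W + W⁻¹·(−σ + q′)) = −i·τ(σ·Im W) − ½ τ(σ²·Re W) − (i/2)·τ(c·Im W)`. [folklore] -/
theorem insertion_alg (τ : 𝔸 →ₗ[ℂ] ℂ) (hτ : ∀ a b : 𝔸, τ (a * b) = τ (b * a)) (W : 𝔸ˣ) (σ c : 𝔸) :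
    -(2 : ℂ)⁻¹ * τ ((σ + (2 : ℂ)⁻¹ • (σ * σ + c)) * (W : 𝔸)
        + ((W⁻¹ : 𝔸ˣ) : 𝔸) * (-σ + (2 : ℂ)⁻¹ • (σ * σ - c)))
      = -(I * τ (σ * imC W)) - (2 : ℂ)⁻¹ * τ (σ * σ * reC W) - I / 2 * τ (c * imC W) := by
  -- move `W⁻¹` to the right by traciality, then write `W`, `W⁻¹` through `Re W`, `Im W`
  rw [map_add τ, hτ ((W⁻¹ : 𝔸ˣ) : 𝔸), ← reC_add_I_smul_imC W]
  conv_lhs => rw [← reC_sub_I_smul_imC W]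
  set R := reC W
  set J := imC W
  simp only [add_mul, sub_mul, mul_add, mul_sub, smul_mul_assoc, mul_smul_comm, map_add, map_sub, map_smul,
    smul_eq_mul, neg_mul, map_neg, mul_assoc]
  ring

end Insertion

/-! ## §3  The exact-background second-order expansion of the per-plaquette functional -/

section Expansion

variable {𝔸 : Type*} [NormedRing 𝔸] [NormedAlgebra ℂ 𝔸] [CompleteSpace 𝔸]

omit [NormedAlgebra ℂ 𝔸] [CompleteSpace 𝔸] in
/-- The size of the inverse path equals the size of the path. [folklore] -/
theorem size_invPath (l : List 𝔸) : size (invPath l) = size l := by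
  induction l with
  | nil => simp
  | cons b l ih => rw [invPath_cons, size, List.map_append, List.sum_append] at *; simp [size] at ih ⊢; rw [ih]; ring

omit [CompleteSpace 𝔸] in
/-- `holPath l 1 = holonomy l`. [folklore] -/
theorem holPath_one (l : List 𝔸) : holPath ℂ l 1 = holonomy l := by
  simp [holPath]

/-- The ordered product of exponentials as a UNIT, inverse = the product along the inverse path
(`AdjointTransportJets.holUnit` at `t = 1`). [folklore] -/
def holU (l : List 𝔸) : 𝔸ˣ := holUnit ℂ l 1

/-- The unit's value is the ordered product of exponentials. [folklore] -/
@[simp] theorem val_holU (l : List 𝔸) : (holU l : 𝔸) = holonomy l := by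
  rw [holU, val_holUnit, holPath_one]

/-- The unit's inverse is the ordered product along the inverse path («U₀(−∂p) = (U₀(∂p))⁻¹», p. 391). [folklore] -/
@[simp] theorem val_inv_holU (l : List 𝔸) : (((holU l)⁻¹ : 𝔸ˣ) : 𝔸) = holonomy (invPath l) := by
  rw [holU, val_inv_holUnit, holPath_one]

/-- The third-order Taylor remainder of the ordered product, `E = P − 1 − Σ a_k − quad l`. [folklore] -/
def rem (l : List 𝔸) : 𝔸 := holonomy l - 1 - l.sum - quad ℂ l

/-- `‖E‖ ≤ expTail 3 (Σ‖a_k‖)` — `Beta.TransportVertices.norm_holonomy_sub_taylor_two_le` BY NAME. [folklore] -/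
theorem norm_rem_le_expTail (l : List 𝔸) : ‖rem l‖ ≤ expTail 3 (size l) :=
  norm_holonomy_sub_taylor_two_le ℂ l

/-- … and for the inverse path, with the SAME size. [folklore] -/
theorem norm_rem_invPath_le_expTail (l : List 𝔸) : ‖rem (invPath l)‖ ≤ expTail 3 (size l) := by
  rw [← size_invPath l]; exact norm_holonomy_sub_taylor_two_le ℂ (invPath l)

/-- `‖E‖ ≤ (s³/6)e^s`, `s = Σ‖a_k‖`: the remainder is THIRD ORDER. [folklore] -/
theorem norm_rem_le_cube (l : List 𝔸) : ‖rem l‖ ≤ size l ^ 3 / 6 * Real.exp (size l) :=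
  norm_holonomy_sub_taylor_two_le' ℂ l

omit [CompleteSpace 𝔸] in
/-- The second-order term of the product: `quad l = ½(σ² + commSum l)` (`TransportVertices.two_smul_quad`). [folklore] -/
theorem quad_eq_half (l : List 𝔸) : quad ℂ l = (2 : ℂ)⁻¹ • (l.sum * l.sum + commSum l) := by
  rw [← two_smul_quad ℂ l, inv_smul_smul₀ two_ne_zero]

omit [CompleteSpace 𝔸] in
/-- The second-order term along the INVERSE path: `quad (invPath l) = ½(σ² − commSum l)` (`sum_inv`, `commSum_inv`). [folklore] -/
theorem quad_invPath_eq_half (l : List 𝔸) : quad ℂ (invPath l) = (2 : ℂ)⁻¹ • (l.sum * l.sum - commSum l) := by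
  rw [← inv_smul_smul₀ (two_ne_zero (α := ℂ)) (quad ℂ (invPath l)), two_smul_quad ℂ (invPath l), sum_inv, commSum_inv,
    neg_mul_neg, sub_eq_add_neg]

/-- **THE EXACT-BACKGROUND SECOND-ORDER EXPANSION** («and we get (3.7)», p. 391, per plaquette, background kept exact):
for fluctuation letters `l = [a₁, …, a_n]`, `P = e^{a₁}⋯e^{a_n}`, `σ = Σ a_k`, `c = Σ_{j<k}[a_j, a_k]`, a unit `W` and a tracial `τ`,
`wil τ (P·W) − wil τ W = −i·τ(σ·Im W) − ½ τ(σ²·Re W) − (i/2)·τ(c·Im W) − ½(τ(E·W) + τ(W⁻¹·E′))`,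
`E = rem l`, `E′ = rem (invPath l)` (both third order, `norm_rem_le_expTail`, `norm_rem_invPath_le_expTail`).
[folklore] [cite: Balaban1985BackgroundPropagators, (3.7) p.391] -/
theorem wil_holonomy_mul (τ : 𝔸 →ₗ[ℂ] ℂ) (hτ : ∀ a b : 𝔸, τ (a * b) = τ (b * a)) (l : List 𝔸) (W : 𝔸ˣ) :
    wil τ (holU l * W) - wil τ W
      = -(I * τ (l.sum * imC W)) - (2 : ℂ)⁻¹ * τ (l.sum * l.sum * reC W) - I / 2 * τ (commSum l * imC W)
        - (2 : ℂ)⁻¹ * (τ (rem l * (W : 𝔸)) + τ (((W⁻¹ : 𝔸ˣ) : 𝔸) * rem (invPath l))) := by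
  have hP : holonomy l = 1 + l.sum + quad ℂ l + rem l := by simp only [rem]; abel
  have hP' : holonomy (invPath l) = 1 - l.sum + quad ℂ (invPath l) + rem (invPath l) := by
    simp only [rem, sum_inv]; abel
  have key := insertion_alg τ hτ W l.sum (commSum l)
  rw [← quad_eq_half, ← quad_invPath_eq_half] at key
  -- unfold the two functionals
  have h1 : wil τ (holU l * W) - wil τ W
      = -(2 : ℂ)⁻¹ * τ ((holonomy l - 1) * (W : 𝔸) + ((W⁻¹ : 𝔸ˣ) : 𝔸) * (holonomy (invPath l) - 1)) := by
    simp only [wil, reC, Units.val_mul, mul_inv_rev, val_holU, val_inv_holU, map_smul, map_add, map_sub, smul_eq_mul,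
      sub_mul, mul_sub, one_mul, mul_one]
    ring
  rw [h1, hP, hP']
  have h2 : (1 + l.sum + quad ℂ l + rem l - 1) * (W : 𝔸) + ((W⁻¹ : 𝔸ˣ) : 𝔸) * (1 - l.sum + quad ℂ (invPath l)
      + rem (invPath l) - 1) = ((l.sum + quad ℂ l) * (W : 𝔸) + ((W⁻¹ : 𝔸ˣ) : 𝔸) * (-l.sum + quad ℂ (invPath l)))
        + (rem l * (W : 𝔸) + ((W⁻¹ : 𝔸ˣ) : 𝔸) * rem (invPath l)) := by noncomm_ring
  rw [h2, map_add, mul_add, key, map_add]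
  ring

/-- THE REMAINDER IS THIRD ORDER, QUANTITATIVELY (continuous tracial `τ`):
`‖½(τ(E·W) + τ(W⁻¹·E′))‖ ≤ ½‖τ‖(‖W‖ + ‖W⁻¹‖)·expTail 3 (Σ‖a_k‖)`. [folklore] -/
theorem norm_rem_le (τ : 𝔸 →L[ℂ] ℂ) (l : List 𝔸) (W : 𝔸ˣ) :
    ‖(2 : ℂ)⁻¹ * (τ (rem l * (W : 𝔸)) + τ (((W⁻¹ : 𝔸ˣ) : 𝔸) * rem (invPath l)))‖
      ≤ 2⁻¹ * ‖τ‖ * (‖(W : 𝔸)‖ + ‖((W⁻¹ : 𝔸ˣ) : 𝔸)‖) * expTail 3 (size l) := by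
  have hE := norm_rem_le_expTail l
  have hE' := norm_rem_invPath_le_expTail l
  have ht : 0 ≤ expTail 3 (size l) := expTail_nonneg 3 (size_nonneg l)
  have h1 : ‖τ (rem l * (W : 𝔸))‖ ≤ ‖τ‖ * (expTail 3 (size l) * ‖(W : 𝔸)‖) :=
    (τ.le_opNorm _).trans (mul_le_mul_of_nonneg_left ((norm_mul_le _ _).trans
      (mul_le_mul_of_nonneg_right hE (norm_nonneg _))) (norm_nonneg _))
  have h2 : ‖τ (((W⁻¹ : 𝔸ˣ) : 𝔸) * rem (invPath l))‖ ≤ ‖τ‖ * (‖((W⁻¹ : 𝔸ˣ) : 𝔸)‖ * expTail 3 (size l)) :=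
    (τ.le_opNorm _).trans (mul_le_mul_of_nonneg_left ((norm_mul_le _ _).trans
      (mul_le_mul_of_nonneg_left hE' (norm_nonneg _))) (norm_nonneg _))
  calc ‖(2 : ℂ)⁻¹ * (τ (rem l * (W : 𝔸)) + τ (((W⁻¹ : 𝔸ˣ) : 𝔸) * rem (invPath l)))‖
      ≤ ‖(2 : ℂ)⁻¹‖ * (‖τ (rem l * (W : 𝔸))‖ + ‖τ (((W⁻¹ : 𝔸ˣ) : 𝔸) * rem (invPath l))‖) := by
        rw [norm_mul]; gcongr; exact norm_add_le _ _
    _ ≤ 2⁻¹ * (‖τ‖ * (expTail 3 (size l) * ‖(W : 𝔸)‖) + ‖τ‖ * (‖((W⁻¹ : 𝔸ˣ) : 𝔸)‖ * expTail 3 (size l))) := by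
        rw [norm_inv, RCLike.norm_ofNat]; gcongr
    _ = 2⁻¹ * ‖τ‖ * (‖(W : 𝔸)‖ + ‖((W⁻¹ : 𝔸ˣ) : 𝔸)‖) * expTail 3 (size l) := by ring

/-- The expansion with the quantitative remainder, for a continuous tracial `τ`. [folklore]
[cite: Balaban1985BackgroundPropagators, (3.7) p.391] -/
theorem norm_wil_holonomy_mul_sub_le (τ : 𝔸 →L[ℂ] ℂ) (hτ : ∀ a b : 𝔸, τ (a * b) = τ (b * a)) (l : List 𝔸) (W : 𝔸ˣ) :
    ‖wil (τ : 𝔸 →ₗ[ℂ] ℂ) (holU l * W) - wil (τ : 𝔸 →ₗ[ℂ] ℂ) W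
        - (-(I * τ (l.sum * imC W)) - (2 : ℂ)⁻¹ * τ (l.sum * l.sum * reC W) - I / 2 * τ (commSum l * imC W))‖
      ≤ 2⁻¹ * ‖τ‖ * (‖(W : 𝔸)‖ + ‖((W⁻¹ : 𝔸ˣ) : 𝔸)‖) * expTail 3 (size l) := by
  have h := wil_holonomy_mul (τ : 𝔸 →ₗ[ℂ] ℂ) (by simpa using hτ) l W
  simp only [ContinuousLinearMap.coe_coe] at h
  rw [h]
  have e : -(I * τ (l.sum * imC W)) - (2 : ℂ)⁻¹ * τ (l.sum * l.sum * reC W) - I / 2 * τ (commSum l * imC W)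
      - (2 : ℂ)⁻¹ * (τ (rem l * (W : 𝔸)) + τ (((W⁻¹ : 𝔸ˣ) : 𝔸) * rem (invPath l)))
      - (-(I * τ (l.sum * imC W)) - (2 : ℂ)⁻¹ * τ (l.sum * l.sum * reC W) - I / 2 * τ (commSum l * imC W))
      = -((2 : ℂ)⁻¹ * (τ (rem l * (W : 𝔸)) + τ (((W⁻¹ : 𝔸ˣ) : 𝔸) * rem (invPath l)))) := by ring
  rw [e, norm_neg]
  exact norm_rem_le τ l W

/-- AT THE TRIVIAL BACKGROUND `W = 1` (`Im 1 = 0`, `Re 1 = 1`): only the square of the letter sum survives at second order,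
`wil τ P = −½ τ(σ²) − ½(τ E + τ E′)` — the first-order and the commutator («spin») terms vanish with `Im U₀(∂p)`. [folklore] -/
theorem wil_holonomy (τ : 𝔸 →ₗ[ℂ] ℂ) (hτ : ∀ a b : 𝔸, τ (a * b) = τ (b * a)) (l : List 𝔸) :
    wil τ (holU l) = -(2 : ℂ)⁻¹ * τ (l.sum * l.sum) - (2 : ℂ)⁻¹ * (τ (rem l) + τ (rem (invPath l))) := by
  have h := wil_holonomy_mul τ hτ l 1
  simp only [mul_one, wil_one, sub_zero, imC_one, reC_one, mul_zero, map_zero, inv_one, Units.val_one, one_mul] at h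
  rw [h]; ring

end Expansion

/-! ## §4  Bałaban's letters: `a_k = iηA′(b_k)`, `X = η⁻¹ Σ A′(b_k)` — the (3.7) summand and (3.6) with the ½ -/

section Letters

variable {𝔸 : Type*} [NormedRing 𝔸] [NormedAlgebra ℂ 𝔸] [CompleteSpace 𝔸]

/-- The fluctuation letters of `U′ = exp iηA` transported to the base point: `a_k = iη·A′(b_k)` («U′ = exp iηA», p. 390;
`A′(b)` as listed under (3.2)). [folklore] -/
def letters (η : ℝ) (A : List 𝔸) : List 𝔸 := A.map (((I * η : ℂ)) • ·)

/-- Print's `(D^η_{U₀}A)(p) = η⁻¹ Σ_{b⊂∂(p)_z} A′(b)` ((3.4) with the `A′` of (3.2)) — HERE A NOTATION for `η⁻¹ Σ_k A′_k`;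
nothing about covariant derivatives is asserted. [folklore] -/
def plaqD (η : ℝ) (A : List 𝔸) : 𝔸 := ((η : ℂ)⁻¹) • A.sum

omit [CompleteSpace 𝔸] in
/-- `Σ a_k = iη·Σ A′_k`. [folklore] -/
theorem sum_letters (η : ℝ) (A : List 𝔸) : (letters η A).sum = (I * η : ℂ) • A.sum := by
  rw [letters, sum_map_smul]

omit [CompleteSpace 𝔸] in
/-- `Σ a_k = iη²·X`. [folklore] -/
theorem sum_letters_eq (η : ℝ) (A : List 𝔸) : (letters η A).sum = (I * η ^ 2 : ℂ) • plaqD η A := by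
  rw [sum_letters, plaqD, smul_smul, pow_two, mul_assoc, mul_self_mul_inv]

omit [CompleteSpace 𝔸] in
/-- `Σ_{j<k}[a_j, a_k] = −η²·Σ_{j<k}[A′_j, A′_k]`. [folklore] -/
theorem commSum_letters (η : ℝ) (A : List 𝔸) : commSum (letters η A) = (-(η : ℂ) ^ 2) • commSum A := by
  rw [letters, commSum_map_smul, mul_pow, Complex.I_sq]; ring_nf

omit [CompleteSpace 𝔸] in
/-- `Σ ‖a_k‖ = |η|·Σ‖A′_k‖`. [folklore] -/
theorem size_letters (η : ℝ) (A : List 𝔸) : size (letters η A) = |η| * size A := by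
  rw [letters, size_map_smul, norm_mul, Complex.norm_I, one_mul, Complex.norm_real, Real.norm_eq_abs]

/-- **THE (3.7) SUMMAND, EXACT BACKGROUND** (p. 391 «and we get (3.7)», per plaquette, at `η^{d−4} = 1`): with `P = Π_k e^{iηA′_k}`,
`X = η⁻¹Σ_k A′_k`, `C = Σ_{b₁≺b₂}[A′(b₁), A′(b₂)]`, a unit `W = U₀(∂p)` and a tracial `τ`,
`wil τ (P·W) − wil τ W = η² τ(X·Im W) + ½η⁴ τ(X²·Re W) + ½η² τ((i·C)·Im W) − ½(τ(E·W) + τ(W⁻¹·E′))`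
— coefficient ½ on the commutator term, as in (3.7)/(3.10). [folklore] [cite: Balaban1985BackgroundPropagators, (3.7) p.391] -/
theorem eq37_summand (τ : 𝔸 →ₗ[ℂ] ℂ) (hτ : ∀ a b : 𝔸, τ (a * b) = τ (b * a)) (η : ℝ) (A : List 𝔸) (W : 𝔸ˣ) :
    wil τ (holU (letters η A) * W) - wil τ W
      = (η : ℂ) ^ 2 * τ (plaqD η A * imC W) + 2⁻¹ * (η : ℂ) ^ 4 * τ (plaqD η A * plaqD η A * reC W)
        + 2⁻¹ * (η : ℂ) ^ 2 * τ ((I • commSum A) * imC W)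
        - (2 : ℂ)⁻¹ * (τ (rem (letters η A) * (W : 𝔸)) + τ (((W⁻¹ : 𝔸ˣ) : 𝔸) * rem (invPath (letters η A)))) := by
  rw [wil_holonomy_mul τ hτ, sum_letters_eq η, commSum_letters]
  simp only [smul_mul_assoc, mul_smul_comm, map_smul, smul_eq_mul]
  have hI : I * I = -1 := Complex.I_mul_I
  linear_combination (-(↑η ^ 2 * τ (plaqD η A * imC W)) - 2⁻¹ * ↑η ^ 4 * τ (plaqD η A * plaqD η A * reC W)) * hI

/-- **THE (3.7) SUMMAND WITH THE POWERS OF `η` AS PRINTED**: multiplying by the `η^{d−4}` of (3.1) (`d ≥ 4`),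
`η^{d−4}(wil τ (P·W) − wil τ W) = η^d τ(X·η⁻²Im W) + ½η^d[τ(X²·Re W) + τ((i·C)·η⁻²Im W)] + η^{d−4}·(remainder)` —
«Σ_p η^d tr(D^η_{U₀}A)(p)η⁻² Im U₀(∂p) + ½Σ_p η^d[tr((D^η_{U₀}A)(p))² Re U₀(∂p) + tr Σ i[A′(b₁),A′(b₂)]η⁻² Im U₀(∂p)]», one `p`.
[folklore] [cite: Balaban1985BackgroundPropagators, (3.1) p.390, (3.7) p.391] -/
theorem eq37_summand_dim (τ : 𝔸 →ₗ[ℂ] ℂ) (hτ : ∀ a b : 𝔸, τ (a * b) = τ (b * a)) (η : ℝ) (hη : η ≠ 0) {d : ℕ} (hd : 4 ≤ d)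
    (A : List 𝔸) (W : 𝔸ˣ) :
    (η : ℂ) ^ (d - 4) * (wil τ (holU (letters η A) * W) - wil τ W)
      = (η : ℂ) ^ d * τ (plaqD η A * (((η : ℂ)⁻¹ ^ 2) • imC W))
        + 2⁻¹ * (η : ℂ) ^ d * (τ (plaqD η A * plaqD η A * reC W) + τ ((I • commSum A) * (((η : ℂ)⁻¹ ^ 2) • imC W)))
        + (η : ℂ) ^ (d - 4) * (-(2 : ℂ)⁻¹ * (τ (rem (letters η A) * (W : 𝔸))
            + τ (((W⁻¹ : 𝔸ˣ) : 𝔸) * rem (invPath (letters η A))))) := by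
  rw [eq37_summand τ hτ η]
  simp only [mul_smul_comm, map_smul, smul_eq_mul]
  have hη' : (η : ℂ) ≠ 0 := Complex.ofReal_ne_zero.mpr hη
  obtain ⟨k, rfl⟩ := Nat.exists_eq_add_of_le hd
  rw [Nat.add_sub_cancel_left, pow_add]
  field_simp
  ring

omit [CompleteSpace 𝔸] in
/-- **(3.6) WITH THE ½** (the plaquette variable itself): `P = Π_k e^{iηA′_k} = 1 + iη²X − ½η⁴X² + ½·iη²·(iC) + E`,
`‖E‖ ≤ expTail 3 (|η|Σ‖A′_k‖)` — the printed display has `iη²` in place of `½·iη²` on the last term (cell record G-adv8-7 (ii) =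
G-an2-16; `Beta.TransportVertices` NOTE); the ½ is forced by `quad = ½(σ² + commSum)`. [folklore]
[cite: Balaban1985BackgroundPropagators, (3.6) p.391] -/
theorem eq36_half (η : ℝ) (A : List 𝔸) :
    holonomy (letters η A) = 1 + (I * η ^ 2 : ℂ) • plaqD η A - ((η : ℂ) ^ 4 / 2) • (plaqD η A * plaqD η A)
      + ((I * η ^ 2 : ℂ) / 2) • (I • commSum A) + rem (letters η A) := by
  have hP : holonomy (letters η A) = 1 + (letters η A).sum + quad ℂ (letters η A) + rem (letters η A) := by
    simp only [rem]; abel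
  rw [hP, quad_eq_half, sum_letters_eq η, commSum_letters, smul_add, smul_mul_smul_comm, smul_smul, smul_smul, smul_smul]
  have h1 : (2 : ℂ)⁻¹ * (I * ↑η ^ 2 * (I * ↑η ^ 2)) = -(↑η ^ 4 / 2) := by
    rw [show I * ↑η ^ 2 * (I * ↑η ^ 2) = (I * I) * ↑η ^ 4 by ring, Complex.I_mul_I]; ring
  have h2 : (2 : ℂ)⁻¹ * -(η : ℂ) ^ 2 = I * ↑η ^ 2 / 2 * I := by
    rw [show I * ↑η ^ 2 / 2 * I = (I * I) * ↑η ^ 2 / 2 by ring, Complex.I_mul_I]; ring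
  rw [h1, h2, neg_smul]
  abel

/-- The remainder of (3.6)/(3.7) in Bałaban's letters is third order in `η·Σ‖A′‖`:
`‖E‖ ≤ (|η|S)³e^{|η|S}/6`, `S = Σ_k ‖A′_k‖` (and the same for `E′` along the inverse path). [folklore] -/
theorem norm_rem_letters_le (η : ℝ) (A : List 𝔸) :
    ‖rem (letters η A)‖ ≤ (|η| * size A) ^ 3 / 6 * Real.exp (|η| * size A) ∧
      ‖rem (invPath (letters η A))‖ ≤ (|η| * size A) ^ 3 / 6 * Real.exp (|η| * size A) := by
  rw [← size_letters]
  exact ⟨norm_rem_le_cube _, (norm_rem_invPath_le_expTail _).trans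
    (expTail_three_le (size_nonneg _))⟩

end Letters

/-! ## §5  Consistency with (3.1) on the group: unitary `W`, self-adjoint letters, a real trace -/

section Unitary

variable {𝔸 : Type*} [Ring 𝔸] [Algebra ℂ 𝔸] [StarRing 𝔸] [StarModule ℂ 𝔸]

/-- For `W⁻¹ = W*` the complexified real part is the self-adjoint part `½(W + W*)`, hence self-adjoint. [folklore] -/
theorem star_reC {W : 𝔸ˣ} (hW : ((W⁻¹ : 𝔸ˣ) : 𝔸) = star (W : 𝔸)) : star (reC W) = reC W := by
  rw [reC, hW, star_smul, star_add, star_star, add_comm]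
  norm_num

/-- For `W⁻¹ = W*` the complexified imaginary part `(1/2i)(W − W*)` is self-adjoint. [folklore] -/
theorem star_imC {W : 𝔸ˣ} (hW : ((W⁻¹ : 𝔸ˣ) : 𝔸) = star (W : 𝔸)) : star (imC W) = imC W := by
  rw [imC_eq, hW, star_smul, star_sub, star_star, ← neg_sub (W : 𝔸), smul_neg, ← neg_smul]
  congr 1
  rw [star_neg, star_div₀, Complex.star_def, Complex.conj_I, map_ofNat]
  ring

omit [StarModule ℂ 𝔸] in
/-- A REAL TRACE SEES THE GENUINE REAL PART: `τ(a*) = conj τ(a)` and `W⁻¹ = W*` give `τ(Re W) = Re τ(W)`. [folklore] -/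
theorem apply_reC {W : 𝔸ˣ} (hW : ((W⁻¹ : 𝔸ˣ) : 𝔸) = star (W : 𝔸)) (τ : 𝔸 →ₗ[ℂ] ℂ)
    (hτs : ∀ a : 𝔸, τ (star a) = starRingEnd ℂ (τ a)) : τ (reC W) = ((τ (W : 𝔸)).re : ℂ) := by
  rw [reC, map_smul, map_add, hW, hτs, Complex.re_eq_add_conj, smul_eq_mul]
  ring

omit [StarModule ℂ 𝔸] in
/-- … and `τ(Im W) = Im τ(W)`. [folklore] -/
theorem apply_imC {W : 𝔸ˣ} (hW : ((W⁻¹ : 𝔸ˣ) : 𝔸) = star (W : 𝔸)) (τ : 𝔸 →ₗ[ℂ] ℂ)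
    (hτs : ∀ a : 𝔸, τ (star a) = starRingEnd ℂ (τ a)) : τ (imC W) = ((τ (W : 𝔸)).im : ℂ) := by
  rw [imC, map_smul, map_sub, hW, hτs, Complex.im_eq_sub_conj, smul_eq_mul]
  field_simp

omit [StarModule ℂ 𝔸] in
/-- **CONSISTENCY WITH (3.1)**: on the group (`W⁻¹ = W*`), for a real normalized trace («tr 1 = 1», p. 392) the complexified
functional IS `1 − Re tr U(∂p)`. [folklore] [cite: Balaban1985BackgroundPropagators, (3.1) p.390, p.391] -/
theorem wil_eq_one_sub_re {W : 𝔸ˣ} (hW : ((W⁻¹ : 𝔸ˣ) : 𝔸) = star (W : 𝔸)) (τ : 𝔸 →ₗ[ℂ] ℂ)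
    (hτs : ∀ a : 𝔸, τ (star a) = starRingEnd ℂ (τ a)) (hτ1 : τ 1 = 1) :
    wil τ W = ((1 - (τ (W : 𝔸)).re : ℝ) : ℂ) := by
  rw [wil, apply_reC hW τ hτs, hτ1, Complex.ofReal_sub, Complex.ofReal_one]

omit [StarModule ℂ 𝔸] in
/-- A tracial real trace of a product of two self-adjoint elements is REAL. [folklore] -/
theorem conj_apply_mul_selfAdjoint (τ : 𝔸 →ₗ[ℂ] ℂ) (hτ : ∀ a b : 𝔸, τ (a * b) = τ (b * a))
    (hτs : ∀ a : 𝔸, τ (star a) = starRingEnd ℂ (τ a)) {x y : 𝔸} (hx : star x = x) (hy : star y = y) :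
    starRingEnd ℂ (τ (x * y)) = τ (x * y) := by
  rw [← hτs, star_mul, hx, hy, hτ]

/-- Self-adjoint letters have a self-adjoint sum and an ANTI-self-adjoint ordered commutator sum:
`(Σ_{j<k}[A′_j, A′_k])* = −Σ_{j<k}[A′_j, A′_k]`. [folklore] -/
theorem star_sum_commSum {𝔹 : Type*} [NormedRing 𝔹] [StarRing 𝔹] (l : List 𝔹) (hl : ∀ a ∈ l, star a = a) :
    star l.sum = l.sum ∧ star (commSum l) = -commSum l := by
  induction l with
  | nil => simp
  | cons b l ih =>
    have hb : star b = b := hl b (by simp)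
    obtain ⟨hs, hc⟩ := ih fun a ha => hl a (by simp [ha])
    refine ⟨by rw [List.sum_cons, star_add, hb, hs], ?_⟩
    rw [commSum_cons, star_add, star_sub, star_mul, star_mul, hb, hs, hc]
    noncomm_ring

/-- **THE THREE COEFFICIENT TRACES OF (3.7) ARE REAL ON THE GROUP**: `W⁻¹ = W*`, self-adjoint `X` and an anti-self-adjoint `C`
(`C* = −C`, so `(iC)* = iC`), tracial real `τ`: `τ(X·Im W)`, `τ(X²·Re W)`, `τ((iC)·Im W)` are fixed by conjugation. [folklore] -/
theorem coefficients_real {W : 𝔸ˣ} (hW : ((W⁻¹ : 𝔸ˣ) : 𝔸) = star (W : 𝔸)) (τ : 𝔸 →ₗ[ℂ] ℂ)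
    (hτ : ∀ a b : 𝔸, τ (a * b) = τ (b * a)) (hτs : ∀ a : 𝔸, τ (star a) = starRingEnd ℂ (τ a))
    {X C : 𝔸} (hX : star X = X) (hC : star C = -C) :
    starRingEnd ℂ (τ (X * imC W)) = τ (X * imC W) ∧
      starRingEnd ℂ (τ (X * X * reC W)) = τ (X * X * reC W) ∧
        starRingEnd ℂ (τ ((I • C) * imC W)) = τ ((I • C) * imC W) := by
  refine ⟨conj_apply_mul_selfAdjoint τ hτ hτs hX (star_imC hW),
    conj_apply_mul_selfAdjoint τ hτ hτs (by rw [star_mul, hX]) (star_reC hW),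
    conj_apply_mul_selfAdjoint τ hτ hτs ?_ (star_imC hW)⟩
  rw [star_smul, hC, Complex.star_def, Complex.conj_I, neg_smul_neg]

end Unitary

/-! ## §6  Sanity examples -/

section Examples

variable {𝔸 : Type*} [NormedRing 𝔸] [NormedAlgebra ℂ 𝔸] [CompleteSpace 𝔸]

/-- The plaquette case `n = 4` of the ordered commutator sum (`TransportVertices.commSum_four` BY NAME): the six ordered pairs
`b₁ ≺ b₂` of the contour `∂(p)_z`. -/
example (a₁ a₂ a₃ a₄ : 𝔸) : commSum [a₁, a₂, a₃, a₄] =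
    (a₁ * a₂ - a₂ * a₁) + (a₁ * a₃ - a₃ * a₁) + (a₁ * a₄ - a₄ * a₁) + (a₂ * a₃ - a₃ * a₂) + (a₂ * a₄ - a₄ * a₂)
      + (a₃ * a₄ - a₄ * a₃) := commSum_four a₁ a₂ a₃ a₄

/-- With NO fluctuation the expansion is exact and trivial: `wil τ (1·W) − wil τ W = 0`. -/
example (τ : 𝔸 →ₗ[ℂ] ℂ) (W : 𝔸ˣ) : wil τ (holU ([] : List 𝔸) * W) - wil τ W = 0 := by
  have : holU ([] : List 𝔸) = 1 := Units.ext (by simp)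
  rw [this, one_mul, sub_self]

end Examples

end Literature.MathematicalPhysics.QuantumFieldTheory.Balaban1983to89.B9Eq37Insertion
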